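import Literature.Computability.AlgebraicComplexity.SmallFormatRankSubstitution
import HarnessLib

/-!
# Hopcroft–Kerr's exchange lemma for single products (HK 1971, Lemma 2) and the substitution step

Topic `Literature/Computability/AlgebraicComplexity` (bilinear complexity; the two reductions behind
the finite-field rank lower bounds of Hopcroft–Kerr 1971 and Wang 2026). Everything here is PROVED
for an arbitrary bilinear map `φ : U × V → W` over a field and an arbitrary bilinear computation
`β : BilinComp φ ι` (Bläser 2003, Def. 1, file `SmallFormatRankSubstitution.lean`); no named
facts.

* `BilinComp.restrictDrop` / `BilinComp.card_restrictDrop` — **the substitution step** (Pan's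
  substitution method; Wang 2026, Lemma 3, one step; Lemma 1, monotonicity, is the case `J = ∅`):
  restricting the first argument to a subspace `U' ≤ U` and discarding the products whose first
  form vanishes on `U'` leaves a computation of `φ|_{U' × V}` of length `|ι| − |J|`.
* `BilinComp.exchange` — one exchange: if a single product `q = a ⊗ b` is a linear combination
  `∑ c_i f_i ⊗ g_i` of the products of `β` with `c_j ≠ 0`, then replacing the `j`-th product
  by `(a, b)` (and re-solving the output vectors) is again a computation of `φ`.
* `hopcroftKerr1971_lemma2` — **HK 1971, Lemma 2** (as restated and proved by exchange in
  Wang 2026, Lemma 2): if `q_0, …, q_{s-1}` are linearly independent single products (rank-one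
  bilinear forms), each a linear combination of the outputs of `φ`, and `φ` has a computation with
  index set `ι`, then `φ` has a computation with the same index set `ι` in which `s` of the
  products are exactly `q_0, …, q_{s-1}`.
* `hopcroftKerr1971_forcedProduct` — the consequence used as the "forced product" technique
  (Wang 2026, §6): stripping those `s` products, some residual map
  `(u, v) ↦ φ(u, v) − ∑_j q_j(u, v) c_j` has a computation of length `|ι| − s`;
  `hopcroftKerr1971_forcedProduct_pi` is the coordinate form for `W = k^τ` in which the residual's
  single-product coordinates vanish (`c_j(κ j') = δ_{j j'}`), leaving `s (t − s)` free
  coefficients.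

Scope note. HK 1971 state Lemma 2 for forms `f_0, …, f_{t-1}` to be computed of which
`f_0, …, f_{s-1}` are single products; "linear combination of the outputs" is what the exchange
proof uses and contains that case (`ℓ_j` = a coordinate projection). The lemma holds over every
field; finiteness of the field only enters Wang's exhaustive enumeration of the residual
coefficients, which is not part of this file.

## References

* J. E. Hopcroft, L. R. Kerr, *On minimizing the number of multiplications necessary for matrix
  multiplication*, SIAM J. Appl. Math. 20 (1971) 30–36, Lemma 2. [HopcroftKerr1971]
* C. Wang, *Automated Lower Bounds for Bilinear Complexity over Finite Fields*, arXiv:2603.07280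
  (2026), §3 Lemma 1, §6 Lemmas 2–3. [Wang2026]
* M. Bläser, J. Complexity 19 (2003) 43–60, Def. 1. [Blaser2003]
-/

namespace Literature.Computability.AlgebraicComplexity

open Module

variable {k : Type*} [Field k]
variable {U V W : Type*} [AddCommGroup U] [Module k U] [AddCommGroup V] [Module k V]
  [AddCommGroup W] [Module k W]
variable {φ : U →ₗ[k] V →ₗ[k] W} {ι : Type*} [Fintype ι]

namespace BilinComp

/-! ## The substitution step: restrict the first argument, drop the vanishing products -/

section Restrict

variable [DecidableEq ι]

/-- Restricting the first argument of `φ` to `U' ≤ U` and discarding a set `J` of products whose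
first forms vanish on `U'`: the remaining triples `(f_i|_{U'}, g_i, w_i)`, `i ∉ J`, compute
`φ|_{U' × V}` (Wang 2026, proof of Lemma 3: "the terms whose A-component that constraint
annihilates drop out, and the surviving terms remain a valid decomposition of the constrained
tensor"). [cite: Wang2026, Lemma 3 (proof)] -/
def restrictDrop (β : BilinComp φ ι) (U' : Submodule k U) (J : Finset ι)
    (hJ : ∀ i ∈ J, ∀ u ∈ U', β.f i u = 0) :
    BilinComp (φ.comp U'.subtype) {i // i ∉ J} where
  f i := (β.f i.1).comp U'.subtype
  g i := β.g i.1
  w i := β.w i.1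
  map_eq_sum u v := by
    classical
    rw [LinearMap.comp_apply, β.map_eq_sum]
    have h1 : ∑ i, (β.f i (U'.subtype u) * β.g i v) • β.w i
        = ∑ i ∈ Finset.univ.filter (fun i => i ∉ J),
            (β.f i (U'.subtype u) * β.g i v) • β.w i := by
      rw [Finset.sum_filter]
      refine Finset.sum_congr rfl fun i _ => ?_
      by_cases hi : i ∉ J
      · simp [hi]
      · rw [not_not] at hi
        simp [hJ i hi _ u.2]
    rw [h1]
    exact Finset.sum_subtype _ (by simp) (fun i => (β.f i (U'.subtype u) * β.g i v) • β.w i)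

/-- The forms and vectors of `restrictDrop`. [cite: Wang2026, Lemma 3 (proof)] -/
@[simp] theorem restrictDrop_f (β : BilinComp φ ι) (U' : Submodule k U) (J : Finset ι)
    (hJ : ∀ i ∈ J, ∀ u ∈ U', β.f i u = 0) (i : {i // i ∉ J}) :
    (β.restrictDrop U' J hJ).f i = (β.f i.1).comp U'.subtype := rfl

/-- The forms and vectors of `restrictDrop`. [cite: Wang2026, Lemma 3 (proof)] -/
@[simp] theorem restrictDrop_g (β : BilinComp φ ι) (U' : Submodule k U) (J : Finset ι)
    (hJ : ∀ i ∈ J, ∀ u ∈ U', β.f i u = 0) (i : {i // i ∉ J}) :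
    (β.restrictDrop U' J hJ).g i = β.g i.1 := rfl

/-- The forms and vectors of `restrictDrop`. [cite: Wang2026, Lemma 3 (proof)] -/
@[simp] theorem restrictDrop_w (β : BilinComp φ ι) (U' : Submodule k U) (J : Finset ι)
    (hJ : ∀ i ∈ J, ∀ u ∈ U', β.f i u = 0) (i : {i // i ∉ J}) :
    (β.restrictDrop U' J hJ).w i = β.w i.1 := rfl

/-- The length of `restrictDrop` is `|ι| − |J|`. [cite: Wang2026, Lemma 3] -/
theorem card_restrictDrop_index (J : Finset ι) :
    Fintype.card {i // i ∉ J} = Fintype.card ι - J.card := by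
  rw [Fintype.card_subtype_compl, Fintype.card_coe]

/-- **The substitution step** (Wang 2026, Lemma 3, one step; Lemma 1 for `J = ∅`): if `φ` has a
computation with index set `ι` in which the first forms of the products `i ∈ J` vanish on the
subspace `U'`, then `φ|_{U' × V}` has a computation of length `|ι| − |J|`.
[cite: Wang2026, Lemma 3 and Lemma 1] -/
theorem exists_restrict_of_forall_eq_zero (β : BilinComp φ ι) (U' : Submodule k U)
    (J : Finset ι) (hJ : ∀ i ∈ J, ∀ u ∈ U', β.f i u = 0) :
    ∃ r, r = Fintype.card ι - J.card ∧ Nonempty (BilinComp (φ.comp U'.subtype) (Fin r)) := by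
  classical
  refine ⟨Fintype.card ι - J.card, rfl, ?_⟩
  have β' := β.restrictDrop U' J hJ
  have e : {i // i ∉ J} ≃ Fin (Fintype.card ι - J.card) :=
    (Fintype.equivFinOfCardEq (card_restrictDrop_index J))
  exact ⟨{ f := fun i => β'.f (e.symm i), g := fun i => β'.g (e.symm i),
            w := fun i => β'.w (e.symm i),
            map_eq_sum := fun u v => by
              rw [β'.map_eq_sum]
              exact (e.symm.sum_comp (fun i => (β'.f i u * β'.g i v) • β'.w i)).symm }⟩

end Restrict

/-! ## One exchange -/

section Exchange

variable [DecidableEq ι]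

/-- **One exchange step** (Wang 2026, proof of Lemma 2): if `a(u) b(v) = ∑_i c_i f_i(u) g_i(v)`
for all `u, v` and `c_j ≠ 0`, then
`f_j(u) g_j(v) = c_j⁻¹ (a(u) b(v) − ∑_{i ≠ j} c_i f_i(u) g_i(v))`, so the triples
`(a, b, c_j⁻¹ w_j)` and `(f_i, g_i, w_i − c_i c_j⁻¹ w_j)` (`i ≠ j`) again compute `φ`.
[cite: Wang2026, Lemma 2 (proof)] -/
def exchange (β : BilinComp φ ι) (j : ι) (a : Dual k U) (b : Dual k V) (c : ι → k)
    (hq : ∀ u v, a u * b v = ∑ i, c i * (β.f i u * β.g i v)) (hc : c j ≠ 0) :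
    BilinComp φ ι where
  f := Function.update β.f j a
  g := Function.update β.g j b
  w i := if i = j then (c j)⁻¹ • β.w j else β.w i - (c i * (c j)⁻¹) • β.w j
  map_eq_sum u v := by
    rw [β.map_eq_sum, ← Finset.add_sum_erase _ _ (Finset.mem_univ j),
      ← Finset.add_sum_erase _ _ (Finset.mem_univ j)]
    rw [Function.update_self, Function.update_self, if_pos rfl]
    have hS : ∀ i ∈ Finset.univ.erase j,
        (Function.update β.f j a i u * Function.update β.g j b i v) •
          (if i = j then (c j)⁻¹ • β.w j else β.w i - (c i * (c j)⁻¹) • β.w j)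
        = (β.f i u * β.g i v) • β.w i
          - (β.f i u * β.g i v * (c i * (c j)⁻¹)) • β.w j := by
      intro i hi
      have hij : i ≠ j := Finset.ne_of_mem_erase hi
      simp only [Function.update_of_ne hij, if_neg hij, smul_sub, smul_smul]
    rw [Finset.sum_congr rfl hS, Finset.sum_sub_distrib, ← Finset.sum_smul]
    -- the coefficient of `w_j`
    have hQ : a u * b v = c j * (β.f j u * β.g j v)
        + ∑ i ∈ Finset.univ.erase j, c i * (β.f i u * β.g i v) := by
      rw [hq, ← Finset.add_sum_erase _ _ (Finset.mem_univ j)]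
    have hcoef : (a u * b v) * (c j)⁻¹
        - ∑ i ∈ Finset.univ.erase j, β.f i u * β.g i v * (c i * (c j)⁻¹)
        = β.f j u * β.g j v := by
      rw [hQ, add_mul, Finset.sum_mul]
      have e1 : ∀ i ∈ Finset.univ.erase j,
          c i * (β.f i u * β.g i v) * (c j)⁻¹ = β.f i u * β.g i v * (c i * (c j)⁻¹) := by
        intro i _; ring
      rw [Finset.sum_congr rfl e1, add_sub_cancel_right, mul_comm (c j), mul_inv_cancel_right₀ hc]
    symm
    calc (a u * b v) • ((c j)⁻¹ • β.w j)
          + (∑ i ∈ Finset.univ.erase j, (β.f i u * β.g i v) • β.w i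
            - (∑ i ∈ Finset.univ.erase j, β.f i u * β.g i v * (c i * (c j)⁻¹)) • β.w j)
        = ((a u * b v) * (c j)⁻¹
            - ∑ i ∈ Finset.univ.erase j, β.f i u * β.g i v * (c i * (c j)⁻¹)) • β.w j
          + ∑ i ∈ Finset.univ.erase j, (β.f i u * β.g i v) • β.w i := by
          rw [sub_smul, smul_smul]; abel
      _ = (β.f j u * β.g j v) • β.w j
          + ∑ i ∈ Finset.univ.erase j, (β.f i u * β.g i v) • β.w i := by rw [hcoef]

/-- The exchanged computation has `(a, b)` as its `j`-th product.
[cite: Wang2026, Lemma 2 (proof)] -/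
@[simp] theorem exchange_f_self (β : BilinComp φ ι) (j : ι) (a : Dual k U) (b : Dual k V)
    (c : ι → k) (hq : ∀ u v, a u * b v = ∑ i, c i * (β.f i u * β.g i v)) (hc : c j ≠ 0) :
    (β.exchange j a b c hq hc).f j = a := by
  simp [exchange]

/-- The exchanged computation has `(a, b)` as its `j`-th product.
[cite: Wang2026, Lemma 2 (proof)] -/
@[simp] theorem exchange_g_self (β : BilinComp φ ι) (j : ι) (a : Dual k U) (b : Dual k V)
    (c : ι → k) (hq : ∀ u v, a u * b v = ∑ i, c i * (β.f i u * β.g i v)) (hc : c j ≠ 0) :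
    (β.exchange j a b c hq hc).g j = b := by
  simp [exchange]

/-- The other products are unchanged by the exchange. [cite: Wang2026, Lemma 2 (proof)] -/
theorem exchange_f_of_ne (β : BilinComp φ ι) (j : ι) (a : Dual k U) (b : Dual k V)
    (c : ι → k) (hq : ∀ u v, a u * b v = ∑ i, c i * (β.f i u * β.g i v)) (hc : c j ≠ 0)
    {i : ι} (hij : i ≠ j) : (β.exchange j a b c hq hc).f i = β.f i := by
  simp [exchange, Function.update_of_ne hij]

/-- The other products are unchanged by the exchange. [cite: Wang2026, Lemma 2 (proof)] -/
theorem exchange_g_of_ne (β : BilinComp φ ι) (j : ι) (a : Dual k U) (b : Dual k V)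
    (c : ι → k) (hq : ∀ u v, a u * b v = ∑ i, c i * (β.f i u * β.g i v)) (hc : c j ≠ 0)
    {i : ι} (hij : i ≠ j) : (β.exchange j a b c hq hc).g i = β.g i := by
  simp [exchange, Function.update_of_ne hij]

end Exchange

end BilinComp

/-! ## Hopcroft–Kerr 1971, Lemma 2 -/

section HK

variable {σ : Type*} [Fintype σ]

/-- The rank-one bilinear form `(u, v) ↦ a(u) b(v)` ("single product").
[cite: HopcroftKerr1971, Lemma 2] -/
abbrev singleProduct (a : Dual k U) (b : Dual k V) : U →ₗ[k] V →ₗ[k] k := a.smulRight b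

omit [Fintype ι] in
/-- Unfolding `singleProduct`. [cite: HopcroftKerr1971, Lemma 2] -/
@[simp] theorem singleProduct_apply (a : Dual k U) (b : Dual k V) (u : U) (v : V) :
    singleProduct a b u v = a u * b v := by
  simp [singleProduct, LinearMap.smulRight_apply]

/-- The inductive exchange (Wang 2026, proof of Lemma 2): for every set `F` of the single products
there is a computation of `φ` with index set `ι` containing the products `q_j`, `j ∈ F`, at
distinct indices. [cite: Wang2026, Lemma 2 (proof)] -/
theorem exists_bilinComp_injOn_of_linearIndependent [DecidableEq ι] [DecidableEq σ]
    (β : BilinComp φ ι) (a : σ → Dual k U) (b : σ → Dual k V)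
    (hind : ∀ g : σ → k, (∀ u v, ∑ j, g j * (a j u * b j v) = 0) → ∀ j, g j = 0)
    (hcomp : ∀ j, ∃ ℓ : Dual k W, ∀ u v, a j u * b j v = ℓ (φ u v)) (F : Finset σ) :
    ∃ (β' : BilinComp φ ι) (e : σ → ι), Set.InjOn e F ∧
      ∀ j ∈ F, β'.f (e j) = a j ∧ β'.g (e j) = b j := by
  classical
  induction F using Finset.induction_on with
  | empty =>
    suffices h : Nonempty (σ → ι) by obtain ⟨e⟩ := h; exact ⟨β, e, by simp, by simp⟩
    rcases isEmpty_or_nonempty ι with hι | ⟨⟨i₀⟩⟩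
    · rcases isEmpty_or_nonempty σ with hσ | ⟨⟨j⟩⟩
      · exact ⟨isEmptyElim⟩
      · -- `q_j ≠ 0`, but it is a combination of the (no) products of `β`
        exfalso
        have hq0 : ∀ u v, a j u * b j v = 0 := by
          obtain ⟨ℓ, hℓ⟩ := hcomp j
          intro u v
          rw [hℓ, β.map_eq_sum]
          simp
        have h1 := hind (fun j' => if j' = j then 1 else 0) (fun u v => by
          simp [hq0 u v]) j
        simp at h1
    · exact ⟨fun _ => i₀⟩
  | insert j F hjF ih =>
    obtain ⟨β₁, e, he, hF⟩ := ih
    -- `q_j` is a combination `∑ c_i p_i` of the products of `β₁`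
    obtain ⟨ℓ, hℓ⟩ := hcomp j
    obtain ⟨c, hc⟩ : ∃ c : ι → k, ∀ i, c i = ℓ (β₁.w i) := ⟨_, fun _ => rfl⟩
    have hq : ∀ u v, a j u * b j v = ∑ i, c i * (β₁.f i u * β₁.g i v) := by
      intro u v
      rw [hℓ, β₁.map_eq_sum, map_sum]
      refine Finset.sum_congr rfl fun i _ => ?_
      rw [map_smul, smul_eq_mul, mul_comm, hc]
    -- some index outside `e '' F` has a nonzero coefficient, by linear independence of the `q`
    have key : ∃ i₁, i₁ ∉ F.image e ∧ c i₁ ≠ 0 := by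
      by_contra hcon
      have hcon' : ∀ i, i ∉ F.image e → c i = 0 := fun i hi =>
        Classical.by_contradiction fun h => hcon ⟨i, hi, h⟩
      -- then `q_j = ∑_{j' ∈ F} c_{e j'} q_{j'}`
      have hsum : ∀ u v, a j u * b j v = ∑ j' ∈ F, c (e j') * (a j' u * b j' v) := by
        intro u v
        have h1 : ∑ i, c i * (β₁.f i u * β₁.g i v)
            = ∑ i ∈ F.image e, c i * (β₁.f i u * β₁.g i v) :=
          (Finset.sum_subset (Finset.subset_univ _) fun i _ hi => by
            rw [hcon' i hi, zero_mul]).symm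
        rw [hq u v, h1, Finset.sum_image he]
        exact Finset.sum_congr rfl fun j' hj' => by rw [(hF j' hj').1, (hF j' hj').2]
      -- contradiction with the linear independence of the `q`
      have h1 := hind (fun j' => if j' = j then -1 else if j' ∈ F then c (e j') else 0)
        (fun u v => by
          rw [← Finset.add_sum_erase _ _ (Finset.mem_univ j), if_pos rfl]
          have hFsub : F ⊆ Finset.univ.erase j := fun j' hj' =>
            Finset.mem_erase.2 ⟨ne_of_mem_of_not_mem hj' hjF, Finset.mem_univ _⟩
          have h2 : ∑ j' ∈ Finset.univ.erase j,
              (if j' = j then -1 else if j' ∈ F then c (e j') else 0) * (a j' u * b j' v)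
              = ∑ j' ∈ F, c (e j') * (a j' u * b j' v) := by
            rw [← Finset.sum_subset hFsub (fun j' hj' hj'F => by
              rw [if_neg (Finset.ne_of_mem_erase hj'), if_neg hj'F, zero_mul])]
            exact Finset.sum_congr rfl fun j' hj' => by
              rw [if_neg (ne_of_mem_of_not_mem hj' hjF), if_pos hj']
          rw [h2, ← hsum u v]
          ring) j
      simp at h1
    obtain ⟨i₁, hi₁F, hci₁⟩ := key
    have hi₁ : ∀ j' ∈ F, e j' ≠ i₁ := fun j' hj' h =>
      hi₁F (Finset.mem_image.2 ⟨j', hj', h⟩)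
    refine ⟨β₁.exchange i₁ (a j) (b j) c hq hci₁, Function.update e j i₁, ?_, ?_⟩
    · -- injectivity on `insert j F`
      intro x hx y hy hxy
      simp only [Finset.coe_insert, Set.mem_insert_iff, Finset.mem_coe] at hx hy
      rcases hx with rfl | hx <;> rcases hy with rfl | hy
      · rfl
      · exfalso
        rw [Function.update_self, Function.update_of_ne (ne_of_mem_of_not_mem hy hjF)] at hxy
        exact hi₁ y hy hxy.symm
      · exfalso
        rw [Function.update_self, Function.update_of_ne (ne_of_mem_of_not_mem hx hjF)] at hxy
        exact hi₁ x hx hxy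
      · rw [Function.update_of_ne (ne_of_mem_of_not_mem hx hjF),
          Function.update_of_ne (ne_of_mem_of_not_mem hy hjF)] at hxy
        exact he hx hy hxy
    · intro j' hj'
      rcases Finset.mem_insert.1 hj' with rfl | hj'
      · simp
      · have hne : j' ≠ j := ne_of_mem_of_not_mem hj' hjF
        rw [Function.update_of_ne hne, BilinComp.exchange_f_of_ne _ _ _ _ _ _ _ (hi₁ j' hj'),
          BilinComp.exchange_g_of_ne _ _ _ _ _ _ _ (hi₁ j' hj')]
        exact hF j' hj'

/-- **Hopcroft–Kerr 1971, Lemma 2** ("Let `f_0, …, f_{t-1}` be bilinear forms of which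
`f_0, …, f_{s-1}` are linearly independent and each is a single product. If the whole set can be
computed with `r` multiplications, then it can be computed with `r` multiplications `s` of which
are exactly `f_0, …, f_{s-1}`"), in the form proved by exchange in Wang 2026, Lemma 2: if the
single products `q_j = a_j ⊗ b_j` (`j ∈ σ`) are linearly independent and each is a linear
combination `ℓ_j ∘ φ` of the outputs of `φ`, then every computation of `φ` with index set
`ι` can be replaced by one with the same index set whose products at the distinct indices `e j` are
exactly `(a_j, b_j)`. [cite: HopcroftKerr1971, Lemma 2] -/
theorem hopcroftKerr1971_lemma2 (β : BilinComp φ ι) (a : σ → Dual k U) (b : σ → Dual k V)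
    (hind : ∀ g : σ → k, (∀ u v, ∑ j, g j * (a j u * b j v) = 0) → ∀ j, g j = 0)
    (hcomp : ∀ j, ∃ ℓ : Dual k W, ∀ u v, a j u * b j v = ℓ (φ u v)) :
    ∃ (β' : BilinComp φ ι) (e : σ ↪ ι),
      ∀ j, β'.f (e j) = a j ∧ β'.g (e j) = b j := by
  classical
  obtain ⟨β', e, he, h⟩ :=
    exists_bilinComp_injOn_of_linearIndependent β a b hind hcomp Finset.univ
  exact ⟨β', ⟨e, fun x y hxy => he (by simp) (by simp) hxy⟩,
    fun j => h j (Finset.mem_univ j)⟩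

/-- In particular `s ≤ r`: a computation of `φ` has at least as many products as there are
independent single products among the combinations of its outputs.
[cite: HopcroftKerr1971, Lemma 2] -/
theorem card_le_card_of_linearIndependent_singleProduct (β : BilinComp φ ι) (a : σ → Dual k U)
    (b : σ → Dual k V)
    (hind : ∀ g : σ → k, (∀ u v, ∑ j, g j * (a j u * b j v) = 0) → ∀ j, g j = 0)
    (hcomp : ∀ j, ∃ ℓ : Dual k W, ∀ u v, a j u * b j v = ℓ (φ u v)) :
    Fintype.card σ ≤ Fintype.card ι := by
  obtain ⟨_, e, _⟩ := hopcroftKerr1971_lemma2 β a b hind hcomp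
  exact Fintype.card_le_of_embedding e

/-! ## The forced-product consequence: strip the single products -/

/-- The residual map `(u, v) ↦ φ(u, v) − ∑_j a_j(u) b_j(v) c_j` after stripping the single
products with output vectors `c_j`. [cite: Wang2026, §6 (forced product)] -/
def residual (φ : U →ₗ[k] V →ₗ[k] W) (a : σ → Dual k U) (b : σ → Dual k V)
    (c : σ → W) : U →ₗ[k] V →ₗ[k] W :=
  φ - ∑ j, (singleProduct (a j) (b j)).compr₂ (LinearMap.toSpanSingleton k W (c j))

omit [Fintype ι] in
/-- Unfolding `residual`. [cite: Wang2026, §6 (forced product)] -/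
@[simp] theorem residual_apply (φ : U →ₗ[k] V →ₗ[k] W) (a : σ → Dual k U)
    (b : σ → Dual k V) (c : σ → W) (u : U) (v : V) :
    residual φ a b c u v = φ u v - ∑ j, (a j u * b j v) • c j := by
  simp [residual, LinearMap.sub_apply, LinearMap.sum_apply, LinearMap.compr₂_apply]

/-- **Forced product** (Hopcroft–Kerr 1971 via Lemma 2; Wang 2026, §6): under the hypotheses of
Lemma 2, for suitable output vectors `c_j` the residual map `φ − ∑_j q_j c_j` has a computation
of length `|ι| − s` — namely the exchanged computation with the `s` literal products removed.
Hence `r ≥ s + (length of the residual)`, minimised over the unknown `c`.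
[cite: Wang2026, §6 (forced product, via Lemma 2)] -/
theorem hopcroftKerr1971_forcedProduct (β : BilinComp φ ι) (a : σ → Dual k U)
    (b : σ → Dual k V)
    (hind : ∀ g : σ → k, (∀ u v, ∑ j, g j * (a j u * b j v) = 0) → ∀ j, g j = 0)
    (hcomp : ∀ j, ∃ ℓ : Dual k W, ∀ u v, a j u * b j v = ℓ (φ u v)) :
    ∃ (c : σ → W) (r : ℕ), r + Fintype.card σ = Fintype.card ι ∧
      Nonempty (BilinComp (residual φ a b c) (Fin r)) := by
  classical
  obtain ⟨β', e, he⟩ := hopcroftKerr1971_lemma2 β a b hind hcomp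
  refine ⟨fun j => β'.w (e j), Fintype.card ι - Fintype.card σ, ?_, ?_⟩
  · have := Fintype.card_le_of_embedding e
    omega
  -- the products outside the range of `e` compute the residual
  let E : Finset ι := Finset.univ.map e
  have hE : E.card = Fintype.card σ := by simp [E]
  have βr : BilinComp (residual φ a b fun j => β'.w (e j)) {i // i ∉ E} :=
    { f := fun i => β'.f i.1, g := fun i => β'.g i.1, w := fun i => β'.w i.1,
      map_eq_sum := fun u v => by
        rw [residual_apply, β'.map_eq_sum]
        have hsplit := (Finset.sum_filter_add_sum_filter_not Finset.univ (fun i => i ∉ E)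
          (fun i => (β'.f i u * β'.g i v) • β'.w i)).symm
        rw [hsplit]
        have h2 : ∑ i ∈ Finset.univ.filter (fun i => ¬ (i ∉ E)),
              (β'.f i u * β'.g i v) • β'.w i
            = ∑ j, (a j u * b j v) • β'.w (e j) := by
          rw [show Finset.univ.filter (fun i => ¬ (i ∉ E)) = E by ext i; simp]
          rw [Finset.sum_map]
          refine Finset.sum_congr rfl fun j _ => ?_
          rw [(he j).1, (he j).2]
        rw [h2, add_sub_cancel_right]
        exact Finset.sum_subtype _ (by simp) (fun i => (β'.f i u * β'.g i v) • β'.w i) }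
  have ecard : Fintype.card {i // i ∉ E} = Fintype.card ι - Fintype.card σ := by
    rw [BilinComp.card_restrictDrop_index, hE]
  let eq : {i // i ∉ E} ≃ Fin (Fintype.card ι - Fintype.card σ) :=
    Fintype.equivFinOfCardEq ecard
  exact ⟨{ f := fun i => βr.f (eq.symm i), g := fun i => βr.g (eq.symm i),
            w := fun i => βr.w (eq.symm i),
            map_eq_sum := fun u v => by
              rw [βr.map_eq_sum]
              exact (eq.symm.sum_comp (fun i => (βr.f i u * βr.g i v) • βr.w i)).symm }⟩

/-- **Forced product, coordinate form** (`W = k^τ`, the single products are the output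
coordinates `κ j`): the output vectors may be normalised so that the residual's coordinates
`κ j'` vanish, i.e. `c_j(κ j') = δ_{j j'}`; the residual then is
`(u, v) ↦ (t ↦ φ_t(u, v) − ∑_j c_j(t) a_j(u) b_j(v))` with only the `c_j(t)`,
`t ∉ range κ`, unknown — `s (t − s)` field elements (Wang 2026, §6: "stripping these `s`
terms leaves `s(t−s)` unknown field coefficients in the residual").
[cite: Wang2026, §6 (forced product)] -/
theorem hopcroftKerr1971_forcedProduct_pi {τ : Type*} [Fintype τ] [DecidableEq τ]
    [DecidableEq σ] {φ : U →ₗ[k] V →ₗ[k] (τ → k)} (β : BilinComp φ ι)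
    (κ : σ ↪ τ) (a : σ → Dual k U) (b : σ → Dual k V)
    (hind : ∀ g : σ → k, (∀ u v, ∑ j, g j * (a j u * b j v) = 0) → ∀ j, g j = 0)
    (hcoord : ∀ j u v, φ u v (κ j) = a j u * b j v) :
    ∃ (c : σ → τ → k) (r : ℕ), (∀ j j', c j (κ j') = if j = j' then 1 else 0) ∧
      r + Fintype.card σ = Fintype.card ι ∧
      Nonempty (BilinComp (residual φ a b c) (Fin r)) := by
  classical
  have hcomp : ∀ j, ∃ ℓ : Dual k (τ → k), ∀ u v, a j u * b j v = ℓ (φ u v) :=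
    fun j => ⟨LinearMap.proj (κ j), fun u v => by simp [hcoord j u v]⟩
  obtain ⟨c, r, hr, ⟨βr⟩⟩ := hopcroftKerr1971_forcedProduct β a b hind hcomp
  -- normalise: overwrite the coordinates `κ j'` of `c_j` by `δ_{j j'}` and of the `w_i` by `0`
  let c' : σ → τ → k := fun j t =>
    if h : (∃ j', κ j' = t) then (if j = h.choose then 1 else 0) else c j t
  have hc' : ∀ j j', c' j (κ j') = if j = j' then 1 else 0 := by
    intro j j'
    have h : ∃ j'', κ j'' = κ j' := ⟨j', rfl⟩
    simp only [c', dif_pos h]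
    have : h.choose = j' := κ.injective h.choose_spec
    rw [this]
  let w' : Fin r → τ → k := fun i t => if (∃ j', κ j' = t) then 0 else βr.w i t
  refine ⟨c', r, hc', hr, ⟨⟨βr.f, βr.g, w', fun u v => ?_⟩⟩⟩
  ext t
  rw [residual_apply]
  simp only [Pi.sub_apply, Finset.sum_apply, Pi.smul_apply, smul_eq_mul]
  by_cases ht : ∃ j', κ j' = t
  · obtain ⟨j', rfl⟩ := ht
    simp only [hc', hcoord, mul_ite, mul_one, mul_zero, Finset.sum_ite_eq', Finset.mem_univ,
      if_true, sub_self]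
    symm
    refine Finset.sum_eq_zero fun i _ => ?_
    simp [w']
  · have hres := congrFun (βr.map_eq_sum u v) t
    rw [residual_apply] at hres
    simp only [Pi.sub_apply, Finset.sum_apply, Pi.smul_apply, smul_eq_mul] at hres
    have e1 : ∀ j, a j u * b j v * c' j t = a j u * b j v * c j t := by
      intro j; simp [c', ht]
    simp only [w', e1, ht, if_false]
    exact hres

end HK

/-! ## Cyclic rotation of a computation (for the other two forced-product orientations) -/

section Rotate

/-- The rotated bilinear map `φ^{rot} : V × W^* → U^*`, `φ^{rot}(v, ℓ) = ℓ ∘ φ(·, v)` (the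
cyclic symmetry of 3-tensors read on bilinear maps; Wang 2026, §6 applies the forced product "for all
three cyclic orientations"). [cite: Wang2026, §6 (forced product, three cyclic orientations)] -/
def rotateMap (φ : U →ₗ[k] V →ₗ[k] W) : V →ₗ[k] Dual k W →ₗ[k] Dual k U :=
  (LinearMap.llcomp k U W k).flip ∘ₗ φ.flip

omit [Fintype ι] in
/-- `φ^{rot}(v, ℓ)(u) = ℓ(φ(u, v))`.
[cite: Wang2026, §6 (forced product, three cyclic orientations)] -/
@[simp] theorem rotateMap_apply (φ : U →ₗ[k] V →ₗ[k] W) (v : V) (ℓ : Dual k W) (u : U) :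
    rotateMap φ v ℓ u = ℓ (φ u v) := rfl

/-- **Rotation of a computation**: `φ(u,v) = ∑ f_i(u) g_i(v) w_i` gives
`φ^{rot}(v, ℓ) = ∑ g_i(v) ℓ(w_i) f_i`, a computation of `φ^{rot}` with the same index set
(products `(g_i, ev_{w_i})`, outputs `f_i`). Hence all three cyclic orientations of a constrained
tensor have computations of the same length, and `hopcroftKerr1971_forcedProduct` applies to
single products among the `V`-slices (of `φ^{rot}`) and the `U`-slices (of `φ^{rot rot}`) as well.
[cite: Wang2026, §6 (forced product, three cyclic orientations)] -/
def BilinComp.rotate {φ : U →ₗ[k] V →ₗ[k] W} (β : BilinComp φ ι) :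
    BilinComp (rotateMap φ) ι where
  f := β.g
  g i := Module.Dual.eval k W (β.w i)
  w := β.f
  map_eq_sum v ℓ := by
    ext u
    rw [rotateMap_apply, β.map_eq_sum, map_sum]
    simp only [LinearMap.coe_sum, Finset.sum_apply, LinearMap.smul_apply, smul_eq_mul,
      map_smul, Module.Dual.eval_apply]
    refine Finset.sum_congr rfl fun i _ => ?_
    ring

/-- The products of the rotated computation.
[cite: Wang2026, §6 (forced product, three cyclic orientations)] -/
@[simp] theorem BilinComp.rotate_f {φ : U →ₗ[k] V →ₗ[k] W} (β : BilinComp φ ι) :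
    β.rotate.f = β.g := rfl

/-- The products of the rotated computation.
[cite: Wang2026, §6 (forced product, three cyclic orientations)] -/
@[simp] theorem BilinComp.rotate_w {φ : U →ₗ[k] V →ₗ[k] W} (β : BilinComp φ ι) :
    β.rotate.w = β.f := rfl

/-- The products of the rotated computation.
[cite: Wang2026, §6 (forced product, three cyclic orientations)] -/
@[simp] theorem BilinComp.rotate_g {φ : U →ₗ[k] V →ₗ[k] W} (β : BilinComp φ ι)
    (i : ι) :
    β.rotate.g i = Module.Dual.eval k W (β.w i) := rfl

end Rotate

end Literature.Computability.AlgebraicComplexity
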